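import Literature.NumberTheory.Automorphic.Liu2021.AppendixC.TowerMorphismLift
import Literature.NumberTheory.Automorphic.Liu2021.AppendixC.EtaleBettiComparisonHolds
import Literature.NumberTheory.Automorphic.Liu2021.AppendixC.BettiPinningTransport
import HarnessLib

/-!
# [Liu 2021, §4.3 / Thm. 4.15 proof] the étale pull-back along a morphism of towers IS the Betti pull-back along
# `Alb(Sh(φ)_K)` under the comparison isomorphism — naturality of the comparison along `albMap` (generic layer)

Topic `NumberTheory/Automorphic/Liu2021/AppendixC`; namespace `Literature.NumberTheory.Automorphic.Liu2021.AppendixC`.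
Continuation of `TowerMorphism(Lift).lean` (the receptacle `Sec42Data.TowerHom` of [Milne2005ShimuraVarieties] Thm. 13.6 with
`albMap K = Alb(Sh(φ)_K)`, `etPullLevel = ᵗV_ℓ(Alb(Sh(φ)_K))`, the étale receptacle `Sec42Data.EtaleTowerHom` with its pull-back
`etPull` on `H¹_ét(A_∞)`, the lift `toEtaleTowerHom`) and of `EtaleBettiComparison(Holds).lean` (the natural comparison family
`H1ComparisonFamily τ' ℓ ι`, the Betti pinning `BettiPinning`, the bijective comparison `cmpLevel` ∕ `cmpAlong : H →ₛₗ[ι]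
ℚ_ℓ^{ac} ⊗ H¹_ét(A_∞)` of a pinned Betti tower).

THE POINT.  Step (S3/S4) of the printed proof of [Liu2021, Thm. 4.15] (p. 51, `FJcycle.tex` l. 2193–2213) DETECTS a class by
its BETTI restriction to a sub-Shimura curve («the image of `c` under the restriction map `H¹_B(Sh(G,h), ℂ) → H¹_B(Sh(G⋆,h⋆), ℂ)`
is nonzero», l. 2212, after [MurtyRamakrishnan1992] Prop. 6), while the tree's seesaw input `S34SomeSource` (`SeesawSource.lean`)
is consumed in ÉTALE currency: `((s.M.toEtaleTowerHom.etPull ℓ).baseChange ℚ_ℓ^{ac}).comp f ≠ 0`.  The bridge between the two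
currencies is the NATURALITY of the comparison isomorphism `H¹_B ⊗_{ℂ,ι} ℚ_ℓ^{ac} ≅ ℚ_ℓ^{ac} ⊗ H¹_ét` ([SGA4Tome3] Exp. XI Thm. 4.4;
the field `H1ComparisonFamily.natural`, PROVED for `h1ComparisonFamilyAlong` in `H1ComparisonFamilyHolds.lean`) along
`Alb(Sh(φ)_K) : A⋆_{φ⁻¹K ∩ K₀⋆} → A_K` — «(4.2) induces the following map» (Thm. 4.18 proof, l. 2254–2262) read for the morphism of
towers of Thm. 4.15's sub-datum.  Proved here ONCE, generically, for EVERY `M : Sec42Data.TowerHom Cₛ C Tₛ T φ hφ` ∕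
`Sec42Data.EtaleTowerHom …`, every natural comparison family `c` and every pair of Betti pinnings `B` (target) ∕ `Bₛ` (source):

* §1 `Sec42Data.BettiPinning.toTower_injective_of_family` — a pinned tower has injective level maps `[·]_K` (bookkeeping
  extracted from `cmpAlong_injective`);
* §2 THE LEVEL SQUARE `Sec42Data.EtaleTowerHom.baseChange_etPull_cmpLevel :
  (1 ⊗ etPull) (cmpLevel K y) = cmpLevel (φ⁻¹K ∩ K₀⋆) (Alb(Sh(φ)_K)^* y)` (= the defining square `etPull_toTower` + `c.natural`);
* §3 the BETTI PULL-BACK ON THE PINNED TOWERS `Sec42Data.TowerHom.bettiPull B Bₛ : H →ₗ[ℂ] Hₛ`,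
  `bettiPull (b_K y) = bₛ_{φ⁻¹K ∩ K₀⋆} (Alb(Sh(φ)_K)^* y)` (well defined by `albMap_Atr` and the pinnings — the ONE definition with a
  body, by choice of a level representative exactly as `cmpAlong`), Hecke-equivariant along `φ` (`bettiPull_rhoB`, from
  `albMap_albTr`, granted `φ(K₀⋆) ⊆ K₀`);
* §4 THE COMPARISON INTERTWINES THE TWO PULL-BACKS: `Sec42Data.EtaleTowerHom.cmpAlong_bettiPull :
  cmpₛ (bettiPull x) = (1 ⊗ etPull) (cmp x)`;
* §5 NONVANISHING TRANSFER: `(1 ⊗ etPull) (cmp x) ≠ 0 ↔ bettiPull x ≠ 0`, its level form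
  `… (cmp (b_K y)) ≠ 0 ↔ Alb(Sh(φ)_K)^* y ≠ 0`, and the Hom-space form `((1 ⊗ etPull)).comp (cmp.comp fB) ≠ 0 ↔
  bettiPull.comp fB ≠ 0` for any `ℂ`-linear `fB : W → H` (the shape of `S34SomeSource`'s first clause, every element of
  `omegaHom` being `cmp ∘ fB` by ★ `BettiComparison.exists_comp_eq`).

Also §6: the §2/§4/§5 statements for the lifted receptacle `M.toEtaleTowerHom.etPull` of a GEOMETRIC `M : TowerHom …` (the
form `S34SomeSource` quantifies).  THEOREMS plus ONE definition with a body (`bettiPull`): NO named fact, NO instance, NO `sorry`;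
net Literature debt 0.  Deliberately NOT here: the detection statement ([MR92] Prop. 6 ∕ row III-8
`MR92Prop6`), the identification `H¹_B(A_K) ≅ H¹(X_K(ℂ), ℂ)` ([Liu2021] Lem. 2.4 (1), ★ `Lemma24OfJacobianDimension`) with its
functoriality under `Sh(φ)_K` (★ `AlbaneseH1Comparison.cmp_comp_bettiPullAlong`), and any particular source (no `SeesawSource`, no
face data).  Cell `hodgecm-mathlib`, line `a3_liu418` (item hLiu418 = [Liu2021, Thm. 4.18]); GS-PROGRAMME §4 F2.  HC_CM is proved
only modulo the 7 printed citations until rung 0 closes; this file discharges none of them by itself.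

## References
* [Liu2021] Y. Liu, *Fourier–Jacobi cycles and arithmetic relative trace formula*, Camb. J. Math. 9 (2021) = arXiv:2102.11518
  (`FJcycle.tex`): §4.2 l. 2070–2081; §4.3 l. 2152–2165; Thm. 4.15 proof p. 51 l. 2193–2213; Thm. 4.18 proof l. 2254–2262.
* [Milne2005ShimuraVarieties] J. S. Milne, *Introduction to Shimura varieties*, Clay Math. Proc. 4 (2005), Thm. 13.6 p. 118,
  Rem. 13.8 p. 119.
* [SGA4Tome3] M. Artin, A. Grothendieck, J.-L. Verdier, SGA 4 Tome 3, Exp. XI Thm. 4.4 (comparison étale/Betti).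
* Tree: `AppendixC.TowerMorphism` ∕ `TowerMorphismLift` (`TowerHom`, `albMap_Atr`, `albMap_albTr`, `etPullLevel`, `EtaleTowerHom`,
  `etPull_toTower'`, `toEtaleTowerHom`), `AppendixC.EtaleBettiComparison(Holds)` (`H1ComparisonFamily`, `BettiPinning`, `cmpLevel`,
  `cmpAlong`), `AppendixC.BettiPinningTransport` (`bettiPullAlong_comp_apply`), `AppendixC.EtaleFaltingsTower` (`toTower_baseChange_injective`).
-/

set_option autoImplicit false

noncomputable section

open CategoryTheory NumberField Function
open scoped TensorProduct

namespace Literature.NumberTheory.Automorphic.Liu2021.AppendixC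

open Literature.AlgebraicGeometry.Motives (AbelianVariety)
open Literature.AlgebraicGeometry.Motives.AbelianVariety (rationalTateModuleMap)

variable {F E : Type} [Field F] [NumberField F] [IsTotallyReal F] [Field E] [NumberField E] [Algebra F E]
  [IsTotallyComplex E] [Algebra.IsQuadraticExtension F E]
variable {P5ₛ P5 : PropC5Data F E} {isoₛ iso : ℕ → Prop}

/-! ## §1 A pinned tower has injective level maps (bookkeeping) -/

namespace Sec42Data.BettiPinning

variable {C : Sec42Data P5 iso} {T : C.HeckeTranslates} {τ' : E →+* ℂ} {H : Type} [AddCommGroup H] [Module ℂ H]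
  {rhoB : Representation ℂ C.G H}

/-- **`[·]_K : H¹_ét(A_K) → H¹_ét(A_∞)` is injective for a PINNED tower**, for ANY natural bijective comparison family `c`: the
pinning makes every `ᵗV_ℓ(Alb_u)` injective (`dualMap_rationalTateModuleMap_Atr_injective`) and a direct limit with injective
transition maps has injective structure maps (★ `toTower_injective`).  (The injectivity half of ★
`toTower_injective_and_range_eq_of_bettiPinning`, which needs no descent hypothesis.)
[cite: Liu2021, §4.3 (FJcycle.tex l. 2154–2158) and Thm. 4.18 (1) l. 2239] -/
theorem toTower_injective_of_family (B : C.BettiPinning T τ' H rhoB) (ℓ : ℕ) [Fact ℓ.Prime]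
    {ι : ℂ ≃+* AlgebraicClosure ℚ_[ℓ]} (c : H1ComparisonFamily (E := E) τ' ℓ ι) (K : C5.SmallLevel C.S.K₀) :
    Injective (C.toTower ℓ K) :=
  C.toTower_injective ℓ (fun _ _ f => B.dualMap_rationalTateModuleMap_Atr_injective ℓ c f) K

/-- … hence so is `[·]_K ⊗ 1 : ℚ_ℓ^{ac} ⊗ H¹_ét(A_K) → ℚ_ℓ^{ac} ⊗ H¹_ét(A_∞)` (`ℚ_ℓ^{ac}` is flat over `ℚ_ℓ`).
[cite: Liu2021, §4.3 (FJcycle.tex l. 2154–2158)] -/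
theorem toTower_baseChange_injective_of_family (B : C.BettiPinning T τ' H rhoB) (ℓ : ℕ) [Fact ℓ.Prime]
    {ι : ℂ ≃+* AlgebraicClosure ℚ_[ℓ]} (c : H1ComparisonFamily (E := E) τ' ℓ ι) (K : C5.SmallLevel C.S.K₀) :
    Injective ((C.toTower ℓ K).baseChange (AlgebraicClosure ℚ_[ℓ])) :=
  toTower_baseChange_injective C ℓ (B.toTower_injective_of_family ℓ c K)

/-- **The level comparison `cmpLevel K = ([·]_K ⊗ 1) ∘ c_{A_K}` of a pinned tower is injective.**
[cite: Liu2021, §4.3 (FJcycle.tex l. 2154–2158)] [cite: SGA4Tome3, Exp. XI Thm. 4.4] -/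
theorem cmpLevel_injective (B : C.BettiPinning T τ' H rhoB) (ℓ : ℕ) [Fact ℓ.Prime]
    (ι : ℂ ≃+* AlgebraicClosure ℚ_[ℓ]) (c : H1ComparisonFamily (E := E) τ' ℓ ι) (K : C5.SmallLevel C.S.K₀) :
    Injective (cmpLevel (C := C) ℓ ι c K) :=
  (B.toTower_baseChange_injective_of_family ℓ c K).comp (c.bijective (C.A K)).1

end Sec42Data.BettiPinning

/-! ## §2 The level square: `(1 ⊗ etPull) ∘ cmpLevel K = cmpLevel (φ⁻¹K ∩ K₀⋆) ∘ Alb(Sh(φ)_K)^*` -/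

namespace Sec42Data.EtaleTowerHom

variable {Cₛ : Sec42Data P5ₛ isoₛ} {C : Sec42Data P5 iso} {Tₛ : Cₛ.HeckeTranslates} {T : C.HeckeTranslates}
  {φ : Cₛ.G →* C.G} {hφ : Continuous φ} (M : Sec42Data.EtaleTowerHom Cₛ C Tₛ T φ hφ) (ℓ : ℕ) [Fact ℓ.Prime]

/-- The defining square of the étale receptacle, base-changed to `ℚ_ℓ^{ac}`:
`(1 ⊗ etPull) ∘ ([·]_K ⊗ 1) = ([·]_{φ⁻¹K ∩ K₀⋆} ⊗ 1) ∘ (1 ⊗ ᵗV_ℓ(Alb(Sh(φ)_K)))`.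
[cite: Liu2021, §4.3 (FJcycle.tex l. 2158) and Thm. 4.18 proof l. 2258–2262] -/
theorem baseChange_etPull_comp_toTower_baseChange (K : C5.SmallLevel C.S.K₀) :
    (M.etPull ℓ).baseChange (AlgebraicClosure ℚ_[ℓ]) ∘ₗ (C.toTower ℓ K).baseChange (AlgebraicClosure ℚ_[ℓ]) =
      (Cₛ.toTower ℓ (M.src K)).baseChange (AlgebraicClosure ℚ_[ℓ]) ∘ₗ
        (M.etPullLevel ℓ K).baseChange (AlgebraicClosure ℚ_[ℓ]) := by
  rw [← LinearMap.baseChange_comp, ← LinearMap.baseChange_comp]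
  congr 1
  exact LinearMap.ext (M.etPull_toTower' ℓ K)

variable {τ' : E →+* ℂ} (ι : ℂ ≃+* AlgebraicClosure ℚ_[ℓ]) (c : H1ComparisonFamily (E := E) τ' ℓ ι)

/-- **Naturality of the comparison along `Alb(Sh(φ)_K)`**, in the receptacle's vocabulary:
`c_{A⋆_{φ⁻¹K ∩ K₀⋆}} (Alb(Sh(φ)_K)^* y) = (1 ⊗ etPullLevel K) (c_{A_K} y)` — the field `H1ComparisonFamily.natural` at the
homomorphism `albMap K`, `etPullLevel K = ᵗV_ℓ(albMap K)` by definition. [cite: SGA4Tome3, Exp. XI Thm. 4.4] [cite: Liu2021, §4.3 (FJcycle.tex l. 2154) and Thm. 4.18 proof l. 2254–2262] -/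
theorem cmp_bettiPullAlong_albMap (K : C5.SmallLevel C.S.K₀) (y : C.bettiH1 τ' K) :
    c.cmp (Cₛ.A (M.src K)) (bettiPullAlong τ' (M.albMap K) y) =
      (M.etPullLevel ℓ K).baseChange (AlgebraicClosure ℚ_[ℓ]) (c.cmp (C.A K) y) :=
  c.natural (M.albMap K) y

/-- **THE LEVEL SQUARE**: `(1 ⊗ etPull) (cmpLevel K y) = cmpLevel (φ⁻¹K ∩ K₀⋆) (Alb(Sh(φ)_K)^* y)` for every small `K` and every
`y ∈ H¹((A_K ×_{τ'} ℂ)(ℂ); ℂ)` — the étale pull-back along the morphism of towers IS the Betti pull-back along `Alb(Sh(φ)_K)`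
under the level comparisons (defining square of `etPull` + naturality of `c`). [cite: Liu2021, §4.3 (FJcycle.tex l. 2154–2160) and Thm. 4.18 proof l. 2254–2262]
[cite: SGA4Tome3, Exp. XI Thm. 4.4] [cite: Milne2005ShimuraVarieties, Thm. 13.6 p. 118] -/
theorem baseChange_etPull_cmpLevel (K : C5.SmallLevel C.S.K₀) (y : C.bettiH1 τ' K) :
    (M.etPull ℓ).baseChange (AlgebraicClosure ℚ_[ℓ]) (BettiPinning.cmpLevel (C := C) ℓ ι c K y) =
      BettiPinning.cmpLevel (C := Cₛ) ℓ ι c (M.src K) (bettiPullAlong τ' (M.albMap K) y) := by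
  rw [BettiPinning.cmpLevel_apply, BettiPinning.cmpLevel_apply, M.cmp_bettiPullAlong_albMap ℓ ι c K y]
  exact LinearMap.congr_fun (M.baseChange_etPull_comp_toTower_baseChange ℓ K) (c.cmp (C.A K) y)

variable {H Hₛ : Type} [AddCommGroup H] [Module ℂ H] [AddCommGroup Hₛ] [Module ℂ Hₛ]
  {rhoB : Representation ℂ C.G H} {rhoBₛ : Representation ℂ Cₛ.G Hₛ}

/-- The level square read on PINNED towers: `(1 ⊗ etPull) (cmp (b_K y)) = cmpₛ (bₛ_{φ⁻¹K ∩ K₀⋆} (Alb(Sh(φ)_K)^* y))`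
(`cmpAlong_b` on both sides). [cite: Liu2021, §4.3 (FJcycle.tex l. 2154–2160) and Thm. 4.18 proof l. 2254–2262] [cite: SGA4Tome3, Exp. XI Thm. 4.4] -/
theorem baseChange_etPull_cmpAlong_b (B : C.BettiPinning T τ' H rhoB) (Bₛ : Cₛ.BettiPinning Tₛ τ' Hₛ rhoBₛ)
    (K : C5.SmallLevel C.S.K₀) (y : C.bettiH1 τ' K) :
    (M.etPull ℓ).baseChange (AlgebraicClosure ℚ_[ℓ]) (B.cmpAlong ℓ ι c (B.b K y)) =
      Bₛ.cmpAlong ℓ ι c (Bₛ.b (M.src K) (bettiPullAlong τ' (M.albMap K) y)) := by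
  rw [B.cmpAlong_b, Bₛ.cmpAlong_b]
  exact M.baseChange_etPull_cmpLevel ℓ ι c K y

end Sec42Data.EtaleTowerHom

/-! ## §3 The Betti pull-back on the pinned towers along a morphism of towers -/

namespace Sec42Data.TowerHom

variable {Cₛ : Sec42Data P5ₛ isoₛ} {C : Sec42Data P5 iso} {Tₛ : Cₛ.HeckeTranslates} {T : C.HeckeTranslates}
  {φ : Cₛ.G →* C.G} {hφ : Continuous φ} (M : Sec42Data.TowerHom Cₛ C Tₛ T φ hφ)
variable {τ' : E →+* ℂ} {H Hₛ : Type} [AddCommGroup H] [Module ℂ H] [AddCommGroup Hₛ] [Module ℂ Hₛ]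
  {rhoB : Representation ℂ C.G H} {rhoBₛ : Representation ℂ Cₛ.G Hₛ}
  (B : C.BettiPinning T τ' H rhoB) (Bₛ : Cₛ.BettiPinning Tₛ τ' Hₛ rhoBₛ)

/-- The level Betti pull-backs `y ↦ bₛ_{φ⁻¹K ∩ K₀⋆} (Alb(Sh(φ)_K)^* y)` into the source's pinned tower are compatible with
`Alb_u^*` (`Alb(Sh(φ)_{K'}) ≫ Alb_u = Alb_{u⋆} ≫ Alb(Sh(φ)_K)`, ★ `albMap_Atr`; contravariance of `H¹_B`; `bₛ_{L⋆} ∘ Alb_{u⋆}^* = bₛ_{K⋆}`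
on the source pinning). [cite: Liu2021, §4.2 (FJcycle.tex l. 2070–2081) and Thm. 4.18 proof l. 2254–2262] -/
theorem b_bettiPullAlong_albMap_Atr {K K' : C5.SmallLevel C.S.K₀} (f : K' ⟶ K) (y : C.bettiH1 τ' K) :
    Bₛ.b (M.src K') (bettiPullAlong τ' (M.albMap K') (bettiPullAlong τ' (C.Atr f) y)) =
      Bₛ.b (M.src K) (bettiPullAlong τ' (M.albMap K) y) := by
  rw [← bettiPullAlong_comp_apply, M.albMap_Atr f, bettiPullAlong_comp_apply, Bₛ.b_bettiPullAlong_Atr]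

/-- **Well-definedness on `H`**: if `b_K y = b_{K'} y'` then the level Betti pull-backs agree (common refinement, `b_injective`) —
the choice-of-level independence behind `bettiPull`. [cite: Liu2021, §4.2 (FJcycle.tex l. 2079–2081) and Thm. 4.18 proof l. 2254–2262] -/
theorem b_bettiPullAlong_albMap_eq_of_b_eq {K K' : C5.SmallLevel C.S.K₀} {y : C.bettiH1 τ' K} {y' : C.bettiH1 τ' K'}
    (h : B.b K y = B.b K' y') :
    Bₛ.b (M.src K) (bettiPullAlong τ' (M.albMap K) y) = Bₛ.b (M.src K') (bettiPullAlong τ' (M.albMap K') y') := by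
  obtain ⟨L, hLK, hLK'⟩ := C5.SmallLevel.exists_le_le K K'
  have hy : bettiPullAlong τ' (C.Atr (homOfLE hLK)) y = bettiPullAlong τ' (C.Atr (homOfLE hLK')) y' := by
    apply B.b_injective L
    rw [B.b_bettiPullAlong_Atr, B.b_bettiPullAlong_Atr, h]
  rw [← M.b_bettiPullAlong_albMap_Atr Bₛ (homOfLE hLK) y, hy, M.b_bettiPullAlong_albMap_Atr]

/-- The level Betti pull-back of the CHOSEN level representative of `x = b_K y` (`exhaust` + choice) is `bₛ_{φ⁻¹K ∩ K₀⋆} (Alb(Sh(φ)_K)^* y)`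
— choice-of-level independence, the form used to build `bettiPull`. [cite: Liu2021, §4.2 (FJcycle.tex l. 2079–2081) and Thm. 4.18 proof l. 2254–2262] -/
theorem b_bettiPullAlong_albMap_choose (x : H) {K : C5.SmallLevel C.S.K₀} {y : C.bettiH1 τ' K} (hx : B.b K y = x) :
    Bₛ.b (M.src (B.exhaust x).choose)
        (bettiPullAlong τ' (M.albMap (B.exhaust x).choose) (B.exhaust x).choose_spec.choose) =
      Bₛ.b (M.src K) (bettiPullAlong τ' (M.albMap K) y) :=
  M.b_bettiPullAlong_albMap_eq_of_b_eq B Bₛ (((B.exhaust x).choose_spec.choose_spec).trans hx.symm)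

/-- **The Betti pull-back `H¹_{B,τ'}(A_∞, ℂ) → H¹_{B,τ'}(A⋆_∞, ℂ)` along the morphism of towers**, on the PINNED towers `H`, `Hₛ`:
the `ℂ`-linear map with `bettiPull (b_K y) = bₛ_{φ⁻¹K ∩ K₀⋆} (Alb(Sh(φ)_K)^* y)` («(4.2) induces the following map
`H¹_{B,τ'}(…) → H¹_{B,τ'}(…)`», Thm. 4.18 proof l. 2254–2257, here for the morphism `Sh(G⋆,h⋆) → Sh(G,h)` of Thm. 4.15's proof,
l. 2193): on `x ∈ H` it is the level pull-back of SOME level representative (`exhaust` + choice), independent of the choice by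
`b_bettiPullAlong_albMap_choose`; additive and `ℂ`-linear because any two classes have a common level.  A definition with a
body (the ONE `def` of this file); nothing asserted.
[cite: Liu2021, Thm. 4.18 proof (FJcycle.tex l. 2254–2262) and Thm. 4.15 proof l. 2193–2212] [cite: Milne2005ShimuraVarieties, Thm. 13.6 p. 118] -/
def bettiPull : H →ₗ[ℂ] Hₛ where
  toFun x := Bₛ.b (M.src (B.exhaust x).choose) (bettiPullAlong τ' (M.albMap (B.exhaust x).choose) (B.exhaust x).choose_spec.choose)
  map_add' x x' := by
    obtain ⟨K, y, hx⟩ := B.exhaust x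
    obtain ⟨K', y', hx'⟩ := B.exhaust x'
    obtain ⟨L, hLK, hLK'⟩ := C5.SmallLevel.exists_le_le K K'
    have hxx' : B.b L (bettiPullAlong τ' (C.Atr (homOfLE hLK)) y + bettiPullAlong τ' (C.Atr (homOfLE hLK')) y') = x + x' := by
      rw [map_add, B.b_bettiPullAlong_Atr, B.b_bettiPullAlong_Atr, hx, hx']
    rw [M.b_bettiPullAlong_albMap_choose B Bₛ (x + x') hxx', M.b_bettiPullAlong_albMap_choose B Bₛ x hx,
      M.b_bettiPullAlong_albMap_choose B Bₛ x' hx', map_add, map_add, M.b_bettiPullAlong_albMap_Atr,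
      M.b_bettiPullAlong_albMap_Atr]
  map_smul' z x := by
    obtain ⟨K, y, hx⟩ := B.exhaust x
    have hzx : B.b K (z • y) = z • x := by rw [map_smul, hx]
    rw [RingHom.id_apply, M.b_bettiPullAlong_albMap_choose B Bₛ (z • x) hzx, M.b_bettiPullAlong_albMap_choose B Bₛ x hx,
      map_smul, map_smul]

/-- **`bettiPull (b_K y) = bₛ_{φ⁻¹K ∩ K₀⋆} (Alb(Sh(φ)_K)^* y)`** — the Betti pull-back IS `Alb(Sh(φ)_K)^*` level by level.
[cite: Liu2021, Thm. 4.18 proof (FJcycle.tex l. 2254–2262)] -/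
theorem bettiPull_b (K : C5.SmallLevel C.S.K₀) (y : C.bettiH1 τ' K) :
    M.bettiPull B Bₛ (B.b K y) = Bₛ.b (M.src K) (bettiPullAlong τ' (M.albMap K) y) :=
  M.b_bettiPullAlong_albMap_choose B Bₛ (B.b K y) rfl

/-- **HECKE EQUIVARIANCE of the Betti pull-back along `φ`**: `bettiPull ((φ g) · x) = g · bettiPull x`, granted the threshold
compatibility `φ(K₀⋆) ⊆ K₀` — the Betti twin of ★ `EtaleTowerHom.etPull_etHeckeRep` («compatible with the action of `G(𝔸_f)`»,
[Milne2005ShimuraVarieties] Thm. 13.6): `rhoB (φ g)` ∕ `rhoBₛ g` are `Alb(T_{φ g})^*` ∕ `Alb(T⋆_g)^*` on the levels (`b_hecke`),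
and `Alb` of the Hecke compatibility `map_tr` (★ `albMap_albTr`) with the refined source level
`g(φ⁻¹K ∩ K₀⋆)g⁻¹ ∩ K₀⋆ ⊆ φ⁻¹((φ g)K(φ g)⁻¹ ∩ K₀) ∩ K₀⋆` (★ `heckeLevel_pullbackLevel_le`).
[cite: Milne2005ShimuraVarieties, Thm. 13.6 p. 118 and Rem. 13.8 p. 119] [cite: Liu2021, §4.2 (FJcycle.tex l. 2074) and Thm. 4.18 proof l. 2254–2262] -/
theorem bettiPull_rhoB (hK₀ : (Cₛ.S.K₀.1 : Subgroup Cₛ.G).map φ ≤ C.S.K₀.1) (g : Cₛ.G) (x : H) :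
    M.bettiPull B Bₛ (rhoB (φ g) x) = rhoBₛ g (M.bettiPull B Bₛ x) := by
  obtain ⟨K, y, rfl⟩ := B.exhaust x
  have h : C5.HeckeLE (φ g) (C5.heckeLevel (φ g) K) K := C5.heckeLE_heckeLevel (φ g) K
  have hₛ : C5.HeckeLE g (C5.heckeLevel g (M.src K)) (M.src K) := C5.heckeLE_heckeLevel g (M.src K)
  have hL : C5.heckeLevel g (M.src K) ≤ M.src (C5.heckeLevel (φ g) K) :=
    C5.heckeLevel_pullbackLevel_le φ hφ hK₀ g K
  rw [B.b_hecke (φ g) _ K h y, bettiPull_b, bettiPull_b, Bₛ.b_hecke g _ (M.src K) hₛ,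
    ← bettiPullAlong_comp_apply, ← bettiPullAlong_comp_apply, ← M.albMap_albTr g _ K h _ hₛ hL,
    bettiPullAlong_comp_apply τ' (Cₛ.Atr (homOfLE hL)), Bₛ.b_bettiPullAlong_Atr]

end Sec42Data.TowerHom

/-! ## §4 The comparison intertwines the Betti and the étale pull-backs -/

namespace Sec42Data.EtaleTowerHom

variable {Cₛ : Sec42Data P5ₛ isoₛ} {C : Sec42Data P5 iso} {Tₛ : Cₛ.HeckeTranslates} {T : C.HeckeTranslates}
  {φ : Cₛ.G →* C.G} {hφ : Continuous φ} (M : Sec42Data.EtaleTowerHom Cₛ C Tₛ T φ hφ) (ℓ : ℕ) [Fact ℓ.Prime]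
variable {τ' : E →+* ℂ} (ι : ℂ ≃+* AlgebraicClosure ℚ_[ℓ]) (c : H1ComparisonFamily (E := E) τ' ℓ ι)
variable {H Hₛ : Type} [AddCommGroup H] [Module ℂ H] [AddCommGroup Hₛ] [Module ℂ Hₛ]
  {rhoB : Representation ℂ C.G H} {rhoBₛ : Representation ℂ Cₛ.G Hₛ}
  (B : C.BettiPinning T τ' H rhoB) (Bₛ : Cₛ.BettiPinning Tₛ τ' Hₛ rhoBₛ)

/-- **THE COMPARISON INTERTWINES THE TWO PULL-BACKS**: `cmpₛ (bettiPull x) = (1 ⊗ etPull) (cmp x)` for every `x ∈ H¹_{B,τ'}(A_∞, ℂ)`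
— «we have a canonical isomorphism `H¹_ét(A_∞ ⊗_{E,τ'} ℂ, ℚ_ℓ^{ac}) ⊗_{ℚ_ℓ^{ac}, ι_ℓ^{-1}} ℂ ≃ H¹_{B,τ'}(A_∞, ℂ)`» (l. 2154), functorial
in the morphism of towers: every class is a level class (`exhaust`), and on level classes this is the level square.
[cite: Liu2021, §4.3 (FJcycle.tex l. 2154–2160) and Thm. 4.18 proof l. 2254–2262] [cite: SGA4Tome3, Exp. XI Thm. 4.4]
[cite: Milne2005ShimuraVarieties, Thm. 13.6 p. 118] -/
theorem cmpAlong_bettiPull (x : H) :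
    Bₛ.cmpAlong ℓ ι c (M.bettiPull B Bₛ x) =
      (M.etPull ℓ).baseChange (AlgebraicClosure ℚ_[ℓ]) (B.cmpAlong ℓ ι c x) := by
  obtain ⟨K, y, rfl⟩ := B.exhaust x
  rw [M.bettiPull_b, M.baseChange_etPull_cmpAlong_b ℓ ι c B Bₛ K y]

/-- The same as an identity of `ι`-semilinear maps `H → ℚ_ℓ^{ac} ⊗ H¹_ét(A⋆_∞)`: `cmpₛ ∘ bettiPull = (1 ⊗ etPull) ∘ cmp`.
[cite: Liu2021, §4.3 (FJcycle.tex l. 2154–2160)] [cite: SGA4Tome3, Exp. XI Thm. 4.4] -/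
theorem cmpAlong_comp_bettiPull :
    (Bₛ.cmpAlong ℓ ι c).comp (M.bettiPull B Bₛ) =
      ((M.etPull ℓ).baseChange (AlgebraicClosure ℚ_[ℓ])).comp (B.cmpAlong ℓ ι c) :=
  LinearMap.ext fun x => M.cmpAlong_bettiPull ℓ ι c B Bₛ x

/-! ## §5 Nonvanishing transfer (the shape of `S34SomeSource`'s first clause) -/

/-- **`(1 ⊗ etPull) (cmp x) ≠ 0 ↔ bettiPull x ≠ 0`**, stated as the equivalence of the vanishings (`cmpₛ` is injective on the
pinned source tower). [cite: Liu2021, Thm. 4.15 proof (FJcycle.tex l. 2212) and §4.3 l. 2154] [cite: SGA4Tome3, Exp. XI Thm. 4.4] -/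
theorem baseChange_etPull_cmpAlong_eq_zero_iff (x : H) :
    (M.etPull ℓ).baseChange (AlgebraicClosure ℚ_[ℓ]) (B.cmpAlong ℓ ι c x) = 0 ↔ M.bettiPull B Bₛ x = 0 := by
  rw [← M.cmpAlong_bettiPull ℓ ι c B Bₛ x]
  exact map_eq_zero_iff _ (Bₛ.cmpAlong_injective ℓ ι c)

/-- **NONVANISHING TRANSFER**: the étale pull-back of the class `cmp x` is non-zero iff the Betti pull-back of `x` is.
[cite: Liu2021, Thm. 4.15 proof (FJcycle.tex l. 2212) and §4.3 l. 2154] [cite: SGA4Tome3, Exp. XI Thm. 4.4] -/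
theorem baseChange_etPull_cmpAlong_ne_zero_iff (x : H) :
    (M.etPull ℓ).baseChange (AlgebraicClosure ℚ_[ℓ]) (B.cmpAlong ℓ ι c x) ≠ 0 ↔ M.bettiPull B Bₛ x ≠ 0 :=
  (M.baseChange_etPull_cmpAlong_eq_zero_iff ℓ ι c B Bₛ x).not

/-- Level form: `(1 ⊗ etPull) (cmp (b_K y)) = 0 ↔ Alb(Sh(φ)_K)^* y = 0` (`bₛ` injective).
[cite: Liu2021, Thm. 4.15 proof (FJcycle.tex l. 2212) and Thm. 4.18 proof l. 2254–2262] -/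
theorem baseChange_etPull_cmpAlong_b_eq_zero_iff (Bₛ : Cₛ.BettiPinning Tₛ τ' Hₛ rhoBₛ) (K : C5.SmallLevel C.S.K₀)
    (y : C.bettiH1 τ' K) :
    (M.etPull ℓ).baseChange (AlgebraicClosure ℚ_[ℓ]) (B.cmpAlong ℓ ι c (B.b K y)) = 0 ↔
      bettiPullAlong τ' (M.albMap K) y = 0 := by
  rw [M.baseChange_etPull_cmpAlong_eq_zero_iff ℓ ι c B Bₛ, M.bettiPull_b]
  exact map_eq_zero_iff _ (Bₛ.b_injective (M.src K))

/-- Level form of the NONVANISHING TRANSFER: `(1 ⊗ etPull) (cmp (b_K y)) ≠ 0 ↔ Alb(Sh(φ)_K)^* y ≠ 0` — «the image of `c` under the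
restriction map … is nonzero» (l. 2212) read in étale currency. [cite: Liu2021, Thm. 4.15 proof (FJcycle.tex l. 2212) and Thm. 4.18 proof l. 2254–2262]
[cite: SGA4Tome3, Exp. XI Thm. 4.4] -/
theorem baseChange_etPull_cmpAlong_b_ne_zero_iff (Bₛ : Cₛ.BettiPinning Tₛ τ' Hₛ rhoBₛ) (K : C5.SmallLevel C.S.K₀)
    (y : C.bettiH1 τ' K) :
    (M.etPull ℓ).baseChange (AlgebraicClosure ℚ_[ℓ]) (B.cmpAlong ℓ ι c (B.b K y)) ≠ 0 ↔
      bettiPullAlong τ' (M.albMap K) y ≠ 0 :=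
  (M.baseChange_etPull_cmpAlong_b_eq_zero_iff ℓ ι c B Bₛ K y).not

/-- The level form WITHOUT a source pinning: `(1 ⊗ etPull) (cmpLevel K y) = 0 ↔ Alb(Sh(φ)_K)^* y = 0` as soon as the source
level map `[·]_{φ⁻¹K ∩ K₀⋆}` is injective (e.g. by §1 from any source pinning, or from row (I) on the source).
[cite: Liu2021, Thm. 4.15 proof (FJcycle.tex l. 2212) and §4.3 l. 2154–2158] [cite: SGA4Tome3, Exp. XI Thm. 4.4] -/
theorem baseChange_etPull_cmpLevel_eq_zero_iff (K : C5.SmallLevel C.S.K₀)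
    (hinj : Injective (Cₛ.toTower ℓ (M.src K))) (y : C.bettiH1 τ' K) :
    (M.etPull ℓ).baseChange (AlgebraicClosure ℚ_[ℓ]) (BettiPinning.cmpLevel (C := C) ℓ ι c K y) = 0 ↔
      bettiPullAlong τ' (M.albMap K) y = 0 := by
  rw [M.baseChange_etPull_cmpLevel ℓ ι c K y, BettiPinning.cmpLevel_apply,
    map_eq_zero_iff _ (toTower_baseChange_injective Cₛ ℓ hinj)]
  exact map_eq_zero_iff _ (c.bijective (Cₛ.A (M.src K))).1

variable {W : Type} [AddCommGroup W] [Module ℂ W]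

/-- **Hom-space form** (the shape of the first clause of `S34SomeSource`): for a `ℂ`-linear `fB : W → H¹_{B,τ'}(A_∞, ℂ)` and
`f := cmp ∘ fB : W →ₛₗ[ι] ℚ_ℓ^{ac} ⊗ H¹_ét(A_∞)` (every element of `omegaHom` is of this form for a `𝔾`-intertwiner `fB`, ★
`BettiComparison.exists_comp_eq` with `(bettiComparisonAlong …).cmp = cmpAlong`), `(1 ⊗ etPull) ∘ f = cmpₛ ∘ (bettiPull ∘ fB)`.
[cite: Liu2021, Thm. 4.15 proof (FJcycle.tex l. 2199–2212) and §4.3 l. 2162–2165] [cite: SGA4Tome3, Exp. XI Thm. 4.4] -/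
theorem baseChange_etPull_comp_cmpAlong_comp (fB : W →ₗ[ℂ] H) :
    ((M.etPull ℓ).baseChange (AlgebraicClosure ℚ_[ℓ])).comp ((B.cmpAlong ℓ ι c).comp fB) =
      (Bₛ.cmpAlong ℓ ι c).comp ((M.bettiPull B Bₛ).comp fB) := by
  apply LinearMap.ext
  intro w
  simp only [LinearMap.comp_apply, M.cmpAlong_bettiPull ℓ ι c B Bₛ]

/-- **Hom-space NONVANISHING TRANSFER**: `(1 ⊗ etPull) ∘ (cmp ∘ fB) ≠ 0 ↔ bettiPull ∘ fB ≠ 0` — the étale pull-back of the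
Hom-space element `cmp ∘ fB` along the morphism of towers is non-zero iff the Betti pull-back of `fB` is.
[cite: Liu2021, Thm. 4.15 proof (FJcycle.tex l. 2199–2212) and §4.3 l. 2162–2165] [cite: SGA4Tome3, Exp. XI Thm. 4.4] -/
theorem baseChange_etPull_comp_cmpAlong_comp_ne_zero_iff (fB : W →ₗ[ℂ] H) :
    ((M.etPull ℓ).baseChange (AlgebraicClosure ℚ_[ℓ])).comp ((B.cmpAlong ℓ ι c).comp fB) ≠ 0 ↔
      (M.bettiPull B Bₛ).comp fB ≠ 0 := by
  rw [M.baseChange_etPull_comp_cmpAlong_comp ℓ ι c B Bₛ fB, not_iff_not]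
  constructor
  · intro h
    apply LinearMap.ext
    intro w
    have hw := LinearMap.congr_fun h w
    rw [LinearMap.comp_apply, LinearMap.zero_apply, map_eq_zero_iff _ (Bₛ.cmpAlong_injective ℓ ι c)] at hw
    rw [hw, LinearMap.zero_apply]
  · intro h
    rw [h, LinearMap.comp_zero]

end Sec42Data.EtaleTowerHom

/-! ## §6 The geometric receptacle `TowerHom` with its lifted pull-back `toEtaleTowerHom.etPull` (the form `S34SomeSource` uses) -/

namespace Sec42Data.TowerHom

variable {Cₛ : Sec42Data P5ₛ isoₛ} {C : Sec42Data P5 iso} {Tₛ : Cₛ.HeckeTranslates} {T : C.HeckeTranslates}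
  {φ : Cₛ.G →* C.G} {hφ : Continuous φ} (M : Sec42Data.TowerHom Cₛ C Tₛ T φ hφ) (ℓ : ℕ) [Fact ℓ.Prime]
variable {τ' : E →+* ℂ} (ι : ℂ ≃+* AlgebraicClosure ℚ_[ℓ]) (c : H1ComparisonFamily (E := E) τ' ℓ ι)
variable {H Hₛ : Type} [AddCommGroup H] [Module ℂ H] [AddCommGroup Hₛ] [Module ℂ Hₛ]
  {rhoB : Representation ℂ C.G H} {rhoBₛ : Representation ℂ Cₛ.G Hₛ}
  (B : C.BettiPinning T τ' H rhoB) (Bₛ : Cₛ.BettiPinning Tₛ τ' Hₛ rhoBₛ)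

/-- §2 for the lifted receptacle: `(1 ⊗ M.toEtaleTowerHom.etPull) (cmpLevel K y) = cmpLevel (φ⁻¹K ∩ K₀⋆) (Alb(Sh(φ)_K)^* y)`.
[cite: Liu2021, §4.3 (FJcycle.tex l. 2154–2160) and Thm. 4.18 proof l. 2254–2262] [cite: SGA4Tome3, Exp. XI Thm. 4.4] -/
theorem baseChange_etPull_toEtaleTowerHom_cmpLevel (K : C5.SmallLevel C.S.K₀) (y : C.bettiH1 τ' K) :
    (M.toEtaleTowerHom.etPull ℓ).baseChange (AlgebraicClosure ℚ_[ℓ]) (BettiPinning.cmpLevel (C := C) ℓ ι c K y) =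
      BettiPinning.cmpLevel (C := Cₛ) ℓ ι c (M.src K) (bettiPullAlong τ' (M.albMap K) y) :=
  M.toEtaleTowerHom.baseChange_etPull_cmpLevel ℓ ι c K y

/-- §4 for the lifted receptacle: `cmpₛ (bettiPull x) = (1 ⊗ M.toEtaleTowerHom.etPull) (cmp x)`.
[cite: Liu2021, §4.3 (FJcycle.tex l. 2154–2160) and Thm. 4.15 proof l. 2193–2212] [cite: SGA4Tome3, Exp. XI Thm. 4.4] -/
theorem cmpAlong_bettiPull (x : H) :
    Bₛ.cmpAlong ℓ ι c (M.bettiPull B Bₛ x) =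
      (M.toEtaleTowerHom.etPull ℓ).baseChange (AlgebraicClosure ℚ_[ℓ]) (B.cmpAlong ℓ ι c x) :=
  M.toEtaleTowerHom.cmpAlong_bettiPull ℓ ι c B Bₛ x

/-- §5 for the lifted receptacle, Hom-space form: `(1 ⊗ M.toEtaleTowerHom.etPull) ∘ (cmp ∘ fB) ≠ 0 ↔ bettiPull ∘ fB ≠ 0` —
LITERALLY the first clause `((s.M.toEtaleTowerHom.etPull ℓ).baseChange ℚ_ℓ^{ac}).comp f ≠ 0` of `S34SomeSource` at `f = cmp ∘ fB`.
[cite: Liu2021, Thm. 4.15 proof (FJcycle.tex l. 2199–2212)] [cite: SGA4Tome3, Exp. XI Thm. 4.4] -/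
theorem baseChange_etPull_toEtaleTowerHom_comp_ne_zero_iff {W : Type} [AddCommGroup W] [Module ℂ W] (fB : W →ₗ[ℂ] H) :
    ((M.toEtaleTowerHom.etPull ℓ).baseChange (AlgebraicClosure ℚ_[ℓ])).comp ((B.cmpAlong ℓ ι c).comp fB) ≠ 0 ↔
      (M.bettiPull B Bₛ).comp fB ≠ 0 :=
  M.toEtaleTowerHom.baseChange_etPull_comp_cmpAlong_comp_ne_zero_iff ℓ ι c B Bₛ fB

/-- §5 for the lifted receptacle, level form: `(1 ⊗ M.toEtaleTowerHom.etPull) (cmp (b_K y)) ≠ 0 ↔ Alb(Sh(φ)_K)^* y ≠ 0`.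
[cite: Liu2021, Thm. 4.15 proof (FJcycle.tex l. 2212) and Thm. 4.18 proof l. 2254–2262] [cite: SGA4Tome3, Exp. XI Thm. 4.4] -/
theorem baseChange_etPull_toEtaleTowerHom_cmpAlong_b_ne_zero_iff (Bₛ : Cₛ.BettiPinning Tₛ τ' Hₛ rhoBₛ)
    (K : C5.SmallLevel C.S.K₀) (y : C.bettiH1 τ' K) :
    (M.toEtaleTowerHom.etPull ℓ).baseChange (AlgebraicClosure ℚ_[ℓ]) (B.cmpAlong ℓ ι c (B.b K y)) ≠ 0 ↔
      bettiPullAlong τ' (M.albMap K) y ≠ 0 :=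
  M.toEtaleTowerHom.baseChange_etPull_cmpAlong_b_ne_zero_iff ℓ ι c B Bₛ K y

end Sec42Data.TowerHom

end Literature.NumberTheory.Automorphic.Liu2021.AppendixC

end
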